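import Literature.AlgebraicGeometry.Modules.PullbackDual
import Literature.AlgebraicGeometry.Modules.LocallyFreeTrace
import Literature.AlgebraicGeometry.Modules.PullbackPushforwardTwist
import HarnessLib

/-!
# The contraction `𝓗om(E, E ⊗ G) ⟶ G` commutes with pull-back

Layer `Literature/AlgebraicGeometry/Modules`; sequel to `PullbackDual.lean` (the twist comparison
`pullbackTwistComparison f hE G : f^* 𝓗om(E^∨, G) ⟶ 𝓗om((f^*E)^∨, f^*G)`, an isomorphism for `E` finite locally free) and
`LocallyFreeTrace.lean` (the contraction `contract hE G : 𝓗om(E, 𝓗om(E^∨, G)) ⟶ G`, `λ ⊗ s ⊗ g ↦ λ(s) g`, glued from the frame sums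
`Σ_i B(b_i)(λ_i)`). For a morphism of schemes `f : X ⟶ Y`, a finite locally free `𝒪_Y`-module `E` and any `𝒪_Y`-module `G`:

* `app_pullbackUnitComparison_unitSection` — `u_f(η(r)) = f♯(r)` (the triangle identity `counit_app_unitSection` of `PullbackPushforwardTwist`);
* `pullbackHomOver_dualBasis_comp_pullbackUnitComparison` — `f^*(λ_i) ≫ u_f = λ'_i`, the dual basis of the pulled-back frame
  (`Modules/PullbackFrame`); hence `app_pullbackDualComparison_unitSection_dualBasis` ∕ `pullbackDualIso_inv_app_dualBasis`
  (`(f^*(E^∨) ≅ (f^*E)^∨)⁻¹ (λ'_i) = η(λ_i)`);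
* `frameContract_pullback` — on a frame `e` of `E` over `W`: `c_{f^*e}(f^*B ≫ twist) = η(c_e(B))` for every
  `B ∈ Γ(𝓗om(E, 𝓗om(E^∨, G)), W)`;
* `contractValue_pullback` — the glued form over any open;
* **`pullback_map_contract`** — `f^*(contract_E^G) = (f^* 𝓗om(E, E ⊗ G) ⟶ 𝓗om(f^*E, f^*(E ⊗ G)) ⟶ 𝓗om(f^*E, f^*E ⊗ f^*G)) ≫ contract_{f^*E}^{f^*G}`,
  i.e. the trace with coefficients is compatible with pull-back (Buchweitz–Flenner §3: functoriality of the trace under base change).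

Motivation: the module-level core of step (Q5) (supertrace compatibility) of the library item (L2) `SigmaPullbackCompat`
(crux stmt-HodgeConjecture-26512, support line «sigma-descent-along-q»); nothing of that crux is asserted here. Everything is proved; no named facts.

## References

* R.-O. Buchweitz, H. Flenner, *A semiregularity map for modules and applications to deformations*, Compositio Math. 137 (2003), §3
  (functoriality of the trace maps under base change) and §4. [BuchweitzFlenner2003]
* R. Hartshorne, *Algebraic Geometry*, GTM 52 (1977), II Ex. 5.1 (b) (the evaluation `E^∨ ⊗ E ⊗ G → G`), II.5 p. 110. [Hartshorne1977]
* U. Görtz, T. Wedhorn, *Algebraic Geometry I*, 2nd ed. (2020), (7.8.3) and Exercise 7.20 (a). [GortzWedhorn2020]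
-/

noncomputable section

-- `TopCat.Presheaf`/`Scheme.Modules` are not reducible (as in Mathlib's `AlgebraicGeometry/Modules/Sheaf.lean`).
set_option backward.isDefEq.respectTransparency false

open CategoryTheory AlgebraicGeometry Opposite TopologicalSpace Limits

universe u

namespace Literature.AlgebraicGeometry.Modules

open Literature.AlgebraicGeometry.Motives

variable {X Y : Scheme.{u}} (f : X ⟶ Y)

/-! ### `u_f` and the dual comparison on pulled-back sections -/

/-- **`u_f(η(r)) = f♯(r)`**: the transpose of the algebra unit on a pulled-back function. [cite: StacksProject, Tag 01AK] -/
theorem app_pullbackUnitComparison_unitSection (W : Y.Opens) (r : Γ(Y, W)) :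
    (pullbackUnitComparison f).app (f ⁻¹ᵁ W) (unitSection f (unitModule Y) W r) = f.app W r := by
  rw [pullbackUnitComparison, Scheme.Modules.Hom.comp_app, ConcreteCategory.comp_apply, pullback_map_app_unitSection,
    algebraUnit_app_apply]
  exact counit_app_unitSection f (unitModule X) W (f.app W r)

variable {E : Y.Modules} {W : Y.Opens} {I : Type u} [Fintype I] (e : SheafOfModules.free I ≅ E.over W)

/-- **`f^*(λ_i) ≫ u_f = λ'_i`**: `f^*` of the `i`-th dual basis element of a frame, composed with `u_f : f^*𝒪_Y ⟶ 𝒪_X`, is the `i`-th dual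
basis element of the pulled-back frame. [cite: Hartshorne1977, II.5 (p. 110) (f^* of a locally free sheaf, same local bases)] -/
theorem pullbackHomOver_dualBasis_comp_pullbackUnitComparison (i : I) :
    pullbackHomOver f (dualBasis e i) ≫ (SheafOfModules.overFunctor _ (f ⁻¹ᵁ W)).map (pullbackUnitComparison f) =
      dualBasis (pullbackFrame f e) i := by
  classical
  refine hom_ext_of_basisSection (pullbackFrame f e) fun j => ?_
  rw [appLE_dualBasis_basisSection, basisSection_pullbackFrame, appLE_comp, appLE_over_map,
    appLE_congr_hom (pullbackHomOver f (dualBasis e i)) (𝟙 _) ((Opens.map f.base).map (𝟙 W)), appLE_pullbackHomOver_unitSection,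
    appLE_dualBasis_basisSection, app_pullbackUnitComparison_unitSection]
  split_ifs
  · exact map_one (f.app W).hom
  · exact map_zero (f.app W).hom

/-- **The dual comparison on `η(λ_i)`**: `(f^*(E^∨) ⟶ (f^*E)^∨)(η(λ_i)) = λ'_i`. [cite: Hartshorne1977, II Ex. 5.1 (b) and (d)] -/
theorem app_pullbackDualComparison_unitSection_dualBasis (i : I) :
    (pullbackDualComparison f E).app (f ⁻¹ᵁ W) (unitSection f (dual E) W (dualBasis e i)) =
      (dualBasis (pullbackFrame f e) i : Γ(dual ((Scheme.Modules.pullback f).obj E), f ⁻¹ᵁ W)) := by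
  rw [pullbackDualComparison, Scheme.Modules.Hom.comp_app, ConcreteCategory.comp_apply,
    app_sheafHomPullbackComparison_unitSection, sheafHomMap_app_apply]
  exact pullbackHomOver_dualBasis_comp_pullbackUnitComparison f e i

/-- **`(f^*(E^∨) ≅ (f^*E)^∨)⁻¹ (λ'_i) = η(λ_i)`** for `E` finite locally free. [cite: Hartshorne1977, II Ex. 5.1 (b) and (d)] -/
theorem pullbackDualIso_inv_app_dualBasis (hE : IsFiniteLocallyFree E) (i : I) :
    (pullbackDualIso f hE).inv.app (f ⁻¹ᵁ W)
        (dualBasis (pullbackFrame f e) i : Γ(dual ((Scheme.Modules.pullback f).obj E), f ⁻¹ᵁ W)) =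
      unitSection f (dual E) W (dualBasis e i) := by
  rw [← app_pullbackDualComparison_unitSection_dualBasis f e i, ← pullbackDualIso_hom f hE, ← ConcreteCategory.comp_apply,
    ← Scheme.Modules.Hom.comp_app, Iso.hom_inv_id, Scheme.Modules.Hom.id_app]
  rfl

/-! ### The contraction in a frame along `f^*` -/

variable (hE : IsFiniteLocallyFree E) (G : Y.Modules)

/-- **On a frame, the contraction commutes with `f^*`**: `c_{f^*e}(f^*B ≫ twist) = η(c_e(B))` for `B : E|_W ⟶ 𝓗om(E^∨, G)|_W`
(summand by summand: `(f^*B)(η b_i) = η(B b_i)`, `twist(η β) = (dual iso)⁻¹ ≫ f^*β`, `(dual iso)⁻¹(λ'_i) = η(λ_i)`, `(f^*β)(η λ_i) = η(β λ_i)`).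
[cite: BuchweitzFlenner2003, §3 (functoriality of the trace under base change)] [cite: Hartshorne1977, II Ex. 5.1 (b)] -/
theorem frameContract_pullback (B : E.over W ⟶ (sheafHom (dual E) G).over W) :
    frameContract ((Scheme.Modules.pullback f).obj G) (pullbackFrame f e)
        (pullbackHomOver f B ≫ (SheafOfModules.overFunctor _ (f ⁻¹ᵁ W)).map (pullbackTwistComparison f hE G)) =
      unitSection f G W (frameContract G e B) := by
  rw [frameContract, frameContract, unitSection_sum]
  refine Finset.sum_congr rfl fun i _ => ?_
  rw [appLE_comp, appLE_over_map, basisSection_pullbackFrame,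
    appLE_congr_hom (pullbackHomOver f B) (𝟙 _) ((Opens.map f.base).map (𝟙 W)), appLE_pullbackHomOver_unitSection,
    pullbackTwistComparison, Scheme.Modules.Hom.comp_app, ConcreteCategory.comp_apply, app_sheafHomPullbackComparison_unitSection,
    sheafHomMapLeft_app_apply, appLE_comp, appLE_over_map, pullbackDualIso_inv_app_dualBasis,
    appLE_congr_hom (pullbackHomOver f (appLE B (𝟙 W) (basisSection e i))) (𝟙 _) ((Opens.map f.base).map (𝟙 W)),
    appLE_pullbackHomOver_unitSection]

/-! ### The glued contraction along `f^*` -/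

/-- Restricting `f^*B ≫ twist` to the preimage of a smaller open. [folklore] -/
private theorem restrictHom_pullbackHomOver_comp_twist {U W' : Y.Opens} (k : W' ⟶ U)
    (B : E.over U ⟶ (sheafHom (dual E) G).over U) :
    restrictHom ((Opens.map f.base).map k)
        (pullbackHomOver f B ≫ (SheafOfModules.overFunctor _ (f ⁻¹ᵁ U)).map (pullbackTwistComparison f hE G)) =
      pullbackHomOver f (restrictHom k B) ≫ (SheafOfModules.overFunctor _ (f ⁻¹ᵁ W')).map (pullbackTwistComparison f hE G) := by
  rw [restrictHom_comp, restrictHom_pullbackHomOver, restrictHom_over_map]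

/-- **The contraction value commutes with `f^*`** over any open `U`:
`contractValue_{f^*E}(f^*B ≫ twist) = η(contractValue_E(B))` (compare on the cover of `f⁻¹U` by the preimages of the framed pieces
`U ∩ U_y`, `map_contractValue` on both schemes and `frameContract_pullback`).
[cite: BuchweitzFlenner2003, §3 (functoriality of the trace under base change)] [cite: Hartshorne1977, II Ex. 5.1 (b)] -/
theorem contractValue_pullback (U : Y.Opens) (B : E.over U ⟶ (sheafHom (dual E) G).over U) :
    contractValue (hE.pullback f) ((Scheme.Modules.pullback f).obj G) (f ⁻¹ᵁ U)
        (pullbackHomOver f B ≫ (SheafOfModules.overFunctor _ (f ⁻¹ᵁ U)).map (pullbackTwistComparison f hE G)) =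
      unitSection f G U (contractValue hE G U B) := by
  refine TopCat.Sheaf.eq_of_locally_eq' ((SheafOfModules.toSheaf _).obj ((Scheme.Modules.pullback f).obj G))
    (fun y : U => f ⁻¹ᵁ (piece hE U y)) (f ⁻¹ᵁ U) (fun y => (Opens.map f.base).map (Opens.infLELeft U (trivNbhd hE y.1))) ?_ _ _
    fun y => ?_
  · intro x hx
    exact Opens.mem_iSup.2 ⟨⟨f.base x, hx⟩, hx, mem_trivNbhd hE (f.base x)⟩
  · change ((Scheme.Modules.pullback f).obj G).presheaf.map ((Opens.map f.base).map (Opens.infLELeft U (trivNbhd hE y.1))).op _ =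
      ((Scheme.Modules.pullback f).obj G).presheaf.map ((Opens.map f.base).map (Opens.infLELeft U (trivNbhd hE y.1))).op _
    rw [map_contractValue (hE.pullback f) ((Scheme.Modules.pullback f).obj G) (pullbackFrame f (pieceFrame hE y))
      ((Opens.map f.base).map (Opens.infLELeft U (trivNbhd hE y.1))), restrictHom_pullbackHomOver_comp_twist,
      frameContract_pullback, ← unitSection_map, map_contractValue hE G (pieceFrame hE y)]

/-- **THE CONTRACTION COMMUTES WITH PULL-BACK**: for `E` finite locally free,
`f^*(contract_E^G) = (f^*𝓗om(E, 𝓗om(E^∨, G)) ⟶ 𝓗om(f^*E, f^*𝓗om(E^∨, G))) ≫ 𝓗om(f^*E, twist) ≫ contract_{f^*E}^{f^*G}` —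
Buchweitz–Flenner's functoriality of the trace with coefficients under base change, in the tree's `𝓗om(E^∨, –)` model of `E ⊗ –`
(both sides are morphisms out of `f^*(…)`: compare transposes on sections, `contractValue_pullback`).
[cite: BuchweitzFlenner2003, §3 (functoriality of the trace under base change) and §4] [cite: Hartshorne1977, II Ex. 5.1 (b)] -/
theorem pullback_map_contract :
    (Scheme.Modules.pullback f).map (contract hE G) =
      sheafHomPullbackComparison f E (sheafHom (dual E) G) ≫
        sheafHomMap ((Scheme.Modules.pullback f).obj E) (pullbackTwistComparison f hE G) ≫
          contract (hE.pullback f) ((Scheme.Modules.pullback f).obj G) := by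
  apply ((Scheme.Modules.pullbackPushforwardAdjunction f).homEquiv _ _).injective
  rw [Adjunction.homEquiv_unit, Adjunction.homEquiv_unit]
  apply Scheme.Modules.hom_ext
  intro U
  ext B
  change ((Scheme.Modules.pullback f).map (contract hE G)).app (f ⁻¹ᵁ U) (unitSection f _ U B) =
    (sheafHomPullbackComparison f E (sheafHom (dual E) G) ≫
      sheafHomMap ((Scheme.Modules.pullback f).obj E) (pullbackTwistComparison f hE G) ≫
        contract (hE.pullback f) ((Scheme.Modules.pullback f).obj G)).app (f ⁻¹ᵁ U) (unitSection f _ U B)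
  rw [pullback_map_app_unitSection, contract_app_apply, Scheme.Modules.Hom.comp_app, Scheme.Modules.Hom.comp_app,
    ConcreteCategory.comp_apply, ConcreteCategory.comp_apply, app_sheafHomPullbackComparison_unitSection, sheafHomMap_app_apply,
    contract_app_apply, contractValue_pullback]

end Literature.AlgebraicGeometry.Modules

end
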